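import Summits.QuantumFields.YangMills.Theorems.UnitScaleTiltFluctuationComparisonRegPrRepAtHeightsSocketOn
import Summits.QuantumFields.YangMills.Theorems.UnitScaleTiltFluctuationComparisonRegPrPrintChiTransfer
import HarnessLib

/-!
# `UnitScaleTiltFluctuationComparisonRegPrRepAtHeightsSocketOnPrintChi` — PRINT'S χ_k VERBATIM AS THE SUB-WINDOW OF THE LOWER ENVELOPE: one finest-scale condition on the
# datum's OWN composite minimiser, measurable for free, feeding the On-χ sockets (crux `FluctuationComparisonRegPrIntL`, stmt-QuantumFields-20520, STUB 2′ — repair phase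
# «R-57χ» of OWNER RULING g23-№2 (+ ADDENDUM 1), acceptance tests (t1)/(t2)/(t5); width-lever lane B «(R1) print's χ back», seat ym-ust-19935-r1 g2)

WHAT PRINT SAYS ([Balaban1985UV3] (47) p.267; p.265 L21–28 ®): the characteristic function of the LOWER bound is «χ_k corresponds to the restrictions on V given by the
conditions |U_k(∂p) − 1| < g_k p(g_k)η², p ⊂ T_η», `U_k = U_k(V)` the minimal configuration determined by `V` — ONE smallness condition on the MINIMISER at the FINEST
scale (in the tree's letters: `PlaqSmall (θBal(K−j)·L^{−2j}) (U_j(V))` for a level-`j` datum of run `K`).  Two consequences the repair needs, both already theorems of the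
cell: (t2-direction) print's χ ⟹ ★r1 g0's `PrintChi.ChiGood` with margin `μ` whenever `2 ≤ (1−μ)·L√L` — [Balaban1985Averaging] Prop. 2 bounds the minimiser's `i`-fold averages by
`2θ·L^{2i}·L^{−2j}`, `L⁻²` per level against the window ratio `L^{−1/2}` (`PrintChiTransfer.chiGood_of_printChi_sharp`, p530363); and (t5) MEASURABILITY: over the datum's own
composite minimiser map `D.Umin K j (D.triv K j)` (measurable for the v3 family: `PkgAtV3.measurable_UkH`) print's χ-set is the PREIMAGE of the measurable small-field event
(`T3UnitScaleTilt.measurableSet_plaqSmall`) — no projection / Fσ argument is needed (the intrinsic `ChiGood`-set, an ∃-projection, would need one).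

* §1 `printChiSets D b₀ p₀ : LevelSets F` — level `j` of run `K`: the sharp field window ∧ (for `j ≤ K`) print's χ_j on `D.Umin K j (D.triv K j)`; `printChiSets_subset_window`;
  **`measurableSet_printChiSets`** from the measurability of the minimiser maps (test (t5));
* §2 **`twoSidedRepOn_of_oneStepTrivOn_printChi`** — the socket of `…RepAtHeightsSocketOn` at `S := printChiSets D b₀ p₀`: `TrivEnvelopeRowsOn (printChiSets D b₀ p₀) D b₀ p₀ →
  MainTermAtHeights → RmSize → PrintChi.TwoSidedRepOn F γ b₀ p₀ (atHeights (printChiSets D b₀ p₀)) ε₀ D.PintH D.EcstH D.RmH`;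
* §4 (append) `printChi_step_margin`/`printChi_step` — test (t2)'s deterministic core: the level-`(j+1)` χ-condition implies the level-`j` one for the SAME finest field with room
  `L^{−3/2}` (`θBal(i) ≤ √L·θBal(i+1)` against `L⁻²` per level);
* §3 **`chiGood_of_atHeights_printChiSets`** — if the datum's trivial-history minimiser at the heights IS a regular minimiser (the `UminTrivIsRegMinimiser` reading; for the v3 family
  `AlphaInputsT3AC.dataOfV3_uminTriv`), then a height-`n` datum in `atHeights (printChiSets D b₀ p₀) K n` is `ChiGood … μ` for `2 ≤ (1−μ)L√L` below print's averaging thresholds —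
  the link to the E-INT consumers' χ-guards (`InteriorExcision.*`, `PrintChi.*`).
Hypothesis schemas only; nothing of [Balaban1985UV3] is asserted.  The choice of the DISPLAY of R3D-02χ is the definer's (alpha lineage); this file shows that print's own χ makes
(t5) bookkeeping and supplies the socket instance and the χ-guard bridge by name.

References: T. Bałaban, CMP 102 (1985) 255–275 [Balaban1985UV3] ((7) p.257, (41) p.266, (47) p.267, p.272); CMP 98 (1985) 17–51 [Balaban1985Averaging] (Prop. 2 (52)–(54) p.26);
CMP 102 (1985) 277–309 [Balaban1985Variational] (Thm 1 (8) p.279).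
-/

set_option autoImplicit false

noncomputable section

namespace Summit.QuantumFields.YangMills.Theorems.LogComparisonRepAtHeightsOn

open MeasureTheory Filter Topology
open Literature.MathematicalPhysics.QuantumFieldTheory.Balaban1983to89
open Literature.MathematicalPhysics.QuantumFieldTheory.Balaban1983to89.T3ContinuumYM3Torus
open Literature.MathematicalPhysics.QuantumFieldTheory.Balaban1983to89.T3LevelShift
open Literature.MathematicalPhysics.QuantumFieldTheory.Balaban1983to89.T3UnitLawDensityEML (ℰp measurableE_ℰp rt)
open Literature.MathematicalPhysics.QuantumFieldTheory.Balaban1983to89.T3UnitScaleTilt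
open Literature.MathematicalPhysics.QuantumFieldTheory.Balaban1983to89.T3RestrictedUnitDensity
open Literature.MathematicalPhysics.QuantumFieldTheory.Balaban1983to89.T3TiltDescent
open Literature.MathematicalPhysics.QuantumFieldTheory.Balaban1983to89.T3RegularMinimiser
open Literature.MathematicalPhysics.QuantumFieldTheory.Balaban1983to89.T3PrintedRegularMinimiser
open Literature.MathematicalPhysics.QuantumFieldTheory.Balaban1983to89.T3LogComparisonSocket
open Literature.MathematicalPhysics.QuantumFieldTheory.Balaban1983to89.T3AlphaInputsAC
open Literature.MathematicalPhysics.QuantumFieldTheory.Balaban1983to89.T3AlphaInputsACTrivEnvelope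
open Literature.MathematicalPhysics.QuantumFieldTheory.Balaban1983to89.Missing
open Literature.MathematicalPhysics.QuantumFieldTheory.Balaban1983to89.ExpMeanLog (deltaSU)
open Summit.QuantumFields.YangMills.Theorems.PrintChi (ChiGood)

/-! ## §1 Print's χ over the datum's own composite minimiser -/

section Sets

variable {F : T3Family} {γ : ℝ} (D : AlphaDataT3 F γ) (b₀ p₀ : ℝ)

/-- **PRINT'S χ AS A SUB-WINDOW FAMILY** (hypothesis-free definition over the datum's exposed minimiser): level `j` of run `K` consists of the fields `U` in the sharp window
`PlaqSmall θBal(K−j)` whose composite minimiser at the trivial history `D.Umin K j (D.triv K j) U` (print's `U_j(U)`) satisfies, when `j ≤ K`, print's lower-bound condition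
`|U_j(∂p) − 1| < θBal(K−j)·L^{−2j}` at every finest plaquette — (47) p.267 «χ_k corresponds to the restrictions on V given by the conditions |U_k(∂p) − 1| < g_k p(g_k)η²».
[cite: Balaban1985UV3, (47) p.267] -/
def printChiSets : LevelSets F := fun K j =>
  {U | PlaqSmall (θBal F.L γ b₀ p₀ (K - j)) U ∧
    (j ≤ K → PlaqSmall (θBal F.L γ b₀ p₀ (K - j) * ((F.L : ℝ)⁻¹) ^ (2 * j)) (D.Umin K j (D.triv K j) U))}

variable {D b₀ p₀}

/-- Print's χ-sets lie inside the sharp windows (by definition). [cite: Balaban1985UV3, (47) p.267] -/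
theorem printChiSets_subset_window (K j : ℕ) : printChiSets D b₀ p₀ K j ⊆ {W | PlaqSmall (θBal F.L γ b₀ p₀ (K - j)) W} :=
  fun _ hU => hU.1

/-- **MEASURABILITY OF PRINT'S χ-SETS (test (t5)) — A PREIMAGE, NOT A PROJECTION**: if the datum's trivial-history composite minimiser maps are measurable (v3 family:
`PkgAtV3.measurable_UkH`), every `printChiSets D b₀ p₀ K j` is measurable (`measurableSet_plaqSmall` twice). [cite: Balaban1985UV3, (47) p.267] -/
theorem measurableSet_printChiSets (hU : ∀ K j, j ≤ K → Measurable (D.Umin K j (D.triv K j))) (K j : ℕ) :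
    MeasurableSet (printChiSets D b₀ p₀ K j) := by
  have h1 : MeasurableSet {U : GaugeField (F.P K) j (Matrix.specialUnitaryGroup (Fin 2) ℂ) | PlaqSmall (θBal F.L γ b₀ p₀ (K - j)) U} :=
    measurableSet_plaqSmall _
  have h2 : MeasurableSet {U : GaugeField (F.P K) j (Matrix.specialUnitaryGroup (Fin 2) ℂ) |
      j ≤ K → PlaqSmall (θBal F.L γ b₀ p₀ (K - j) * ((F.L : ℝ)⁻¹) ^ (2 * j)) (D.Umin K j (D.triv K j) U)} := by
    by_cases hj : j ≤ K
    · have hpre : MeasurableSet ((D.Umin K j (D.triv K j)) ⁻¹'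
          {W : GaugeField (F.P K) 0 (Matrix.specialUnitaryGroup (Fin 2) ℂ) | PlaqSmall (θBal F.L γ b₀ p₀ (K - j) * ((F.L : ℝ)⁻¹) ^ (2 * j)) W}) :=
        hU K j hj (measurableSet_plaqSmall _)
      have e : {U : GaugeField (F.P K) j (Matrix.specialUnitaryGroup (Fin 2) ℂ) |
          j ≤ K → PlaqSmall (θBal F.L γ b₀ p₀ (K - j) * ((F.L : ℝ)⁻¹) ^ (2 * j)) (D.Umin K j (D.triv K j) U)} =
          (D.Umin K j (D.triv K j)) ⁻¹'
            {W : GaugeField (F.P K) 0 (Matrix.specialUnitaryGroup (Fin 2) ℂ) | PlaqSmall (θBal F.L γ b₀ p₀ (K - j) * ((F.L : ℝ)⁻¹) ^ (2 * j)) W} := by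
        ext U
        simp only [Set.mem_setOf_eq, Set.mem_preimage]
        exact ⟨fun h => h hj, fun h _ => h⟩
      rw [e]
      exact hpre
    · have e : {U : GaugeField (F.P K) j (Matrix.specialUnitaryGroup (Fin 2) ℂ) |
          j ≤ K → PlaqSmall (θBal F.L γ b₀ p₀ (K - j) * ((F.L : ℝ)⁻¹) ^ (2 * j)) (D.Umin K j (D.triv K j) U)} = Set.univ := by
        ext U
        simp only [Set.mem_setOf_eq, Set.mem_univ, iff_true]
        exact fun h => absurd h hj
      rw [e]
      exact MeasurableSet.univ
  exact h1.inter h2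

end Sets

/-! ## §2 The socket at print's χ -/

section Socket

variable {F : T3Family} {γ : ℝ} {D : AlphaDataT3 F γ} {b₀ p₀ ε₀ C q : ℝ}

/-- **CONJUNCT (A) ON PRINT'S χ FROM NAMED ROWS**: the trivial-envelope rows with the LOWER one on print's χ-sets (`TrivEnvelopeRowsOn (printChiSets D b₀ p₀)`: the (47) recursion with
`χ_{j+1}` on the left and `χ_j` inside, χ = the minimiser's finest-scale window), the main-term identification at the heights and the printed remainder size give
`PrintChi.TwoSidedRepOn` at the data whose reading is print-χ-good — `twoSidedRepOn_of_oneStepTrivOn` at `S := printChiSets D b₀ p₀`, measurability by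
`measurableSet_printChiSets`. [cite: Balaban1985UV3, (41) p.266 and (47) p.267; Balaban1985Variational, Thm 1 (8) p.279] -/
theorem twoSidedRepOn_of_oneStepTrivOn_printChi (hγ : 0 ≤ γ) (hU : ∀ K j, j ≤ K → Measurable (D.Umin K j (D.triv K j)))
    (hrows : TrivEnvelopeRowsOn (printChiSets D b₀ p₀) D b₀ p₀) (hmain : MainTermAtHeights D b₀ p₀ ε₀) (hRm : RmSize D C q) :
    PrintChi.TwoSidedRepOn F γ b₀ p₀ (atHeights (printChiSets D b₀ p₀)) ε₀ D.PintH D.EcstH D.RmH :=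
  twoSidedRepOn_of_oneStepTrivOn hγ (measurableSet_printChiSets hU) (fun K j _ => printChiSets_subset_window K j) hrows hmain hRm

end Socket

/-! ## §3 Print's χ at the heights implies the χ-good guards of the interior-excision consumers -/

section Bridge

variable {F : T3Family} {γ b₀ p₀ ε₀ μ : ℝ} {D : AlphaDataT3 F γ}

/-- **PRINT'S χ AT A HEIGHT ⟹ `ChiGood` WITH EVERY MARGIN `μ` SUCH THAT `2 ≤ (1−μ)·L√L`** (the χ-guards of `InteriorExcision.*` / `PrintChi.*`): if the datum's trivial-history
composite minimiser at the comparison height IS a regular minimiser of the fibre problem (the `UminTrivIsRegMinimiser` reading — for the v3 family `AlphaInputsT3AC.dataOfV3_uminTriv`,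
hypothesis `hreg`), the coupling is below print's averaging thresholds (`C₀θBal(n) ≤ ⅓`, `θBal(n) ≤ δ₂/(7L)²`), and the height-`n` datum `V` lies in `atHeights (printChiSets D b₀ p₀) K n`,
then `V` is χ-good with margin `μ` (`PrintChiTransfer.chiGood_of_printChi_sharp`, p530363: [Balaban1985Averaging] Prop. 2 bounds the minimiser's averages by `2θ·L^{2i}·L^{−2(K−n)}`).
L = 3: every `μ ≤ 1 − 2/√27`. [cite: Balaban1985UV3, (47) p.267; Balaban1985Averaging, Prop. 2 (52)–(54) p.26] -/
theorem chiGood_of_atHeights_printChiSets (hγ : 0 < γ) (hγ1 : γ ≤ 1) (hb : 0 < b₀) (hp : 0 ≤ p₀) {n K : ℕ} (hnK : n < K)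
    {V : GaugeField (F.P n) 0 (Matrix.specialUnitaryGroup (Fin 2) ℂ)}
    (hreg : D.Umin K (K - n) (D.triv K (K - n))
        (fieldShift (F.sitesPerDir_eq (m := F.m) (K := K) (j := K - n) (m' := F.m) (K' := n) (j' := 0) (by omega)) V) ∈ regFibrePr F n K hnK.le ε₀ V ∧
      wilsonAction4 (D.Umin K (K - n) (D.triv K (K - n))
        (fieldShift (F.sitesPerDir_eq (m := F.m) (K := K) (j := K - n) (m' := F.m) (K' := n) (j' := 0) (by omega)) V)) = minActionRegPr F n K hnK.le ε₀ V)
    (hθ3 : (143 * ((((3 + 4 : ℕ) : ℝ)) ^ 2 / 4) ^ 2) * θBal F.L γ b₀ p₀ n ≤ 1 / 3)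
    (hθ2 : 2 * θBal F.L γ b₀ p₀ n ≤ 2 * deltaSU (Fin 2) / (((3 + 4) * F.L : ℕ) : ℝ) ^ 2)
    (hμ : 2 ≤ (1 - μ) * ((F.L : ℝ) * Real.sqrt F.L))
    (hV : atHeights (printChiSets D b₀ p₀) K n hnK.le V) :
    ChiGood F γ b₀ p₀ ε₀ μ hnK.le V := by
  obtain ⟨-, hχ⟩ := hV
  have hχ' := hχ (Nat.sub_le K n)
  rw [show K - (K - n) = n by omega] at hχ'
  exact PrintChi.chiGood_of_printChi_sharp hγ hγ1 hb hp hnK.le hreg.1 hreg.2 hχ' hθ3 hθ2 hμ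

end Bridge



/-! ## §4 Print's χ is hereditary down the minimiser tower: the threshold arithmetic (test (t2), deterministic core) -/

section Heredity

variable {F : T3Family} {γ b₀ p₀ : ℝ}

/-- **PRINT'S χ ONE LEVEL DOWN, WITH ROOM `(√(L⁻¹))³`** (test (t2), deterministic core; r1 g2 APPEND): the finest-scale condition of a level-`(j+1)` datum of run `K`
(height `i`), `|U(∂p) − 1| < θBal(i)·L^{−2(j+1)}` on a finest field `U`, implies the level-`j` condition (height `i+1`) for the SAME field with room `(√(L⁻¹))³ = L^{−3/2}`:
`|U(∂p) − 1| < (√(L⁻¹))³·θBal(i+1)·L^{−2j}` — one level costs `L⁻²` in the threshold while the windows only shrink by `θBal(i) ≤ √L·θBal(i+1)`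
(`T3SmallLiftHistory.sqrt_inv_mul_θBal_le_succ`).  With the tower property of the composite minimisers ([Balaban1985UV3] (52) p.268: the minimiser of the conditional mean one
level down IS the same finest field) this is why (47)'s `χ_k` closes its recursion at EVERY block size (`L = 3`: room `27^{−1/2} ≈ 0.19`); the Gaussian-bulk half of (t2) is the
suppliers' analysis. [cite: Balaban1985UV3, (47) p.267 and (52) p.268] -/
theorem printChi_step_margin (hγ : 0 < γ) (hγ1 : γ ≤ 1) (hb : 0 ≤ b₀) (hp : 0 ≤ p₀) {K : ℕ} (i j : ℕ)
    {U : GaugeField (F.P K) 0 (Matrix.specialUnitaryGroup (Fin 2) ℂ)}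
    (hχ : PlaqSmall (θBal F.L γ b₀ p₀ i * ((F.L : ℝ)⁻¹) ^ (2 * (j + 1))) U) :
    PlaqSmall (Real.sqrt ((F.L : ℝ)⁻¹) ^ 3 * (θBal F.L γ b₀ p₀ (i + 1) * ((F.L : ℝ)⁻¹) ^ (2 * j))) U := by
  have hL : 1 ≤ F.L := F.hL.2.le
  have hLinv : 0 ≤ ((F.L : ℝ)⁻¹) := inv_nonneg.mpr (Nat.cast_nonneg F.L)
  set s : ℝ := Real.sqrt ((F.L : ℝ)⁻¹) with hs
  have hs0 : 0 ≤ s := Real.sqrt_nonneg _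
  have hs2 : s ^ 2 = (F.L : ℝ)⁻¹ := Real.sq_sqrt hLinv
  have hstep : s * θBal F.L γ b₀ p₀ i ≤ θBal F.L γ b₀ p₀ (i + 1) := T3SmallLiftHistory.sqrt_inv_mul_θBal_le_succ hL hγ hγ1 hb hp i
  have e : θBal F.L γ b₀ p₀ i * ((F.L : ℝ)⁻¹) ^ (2 * (j + 1)) = (s * θBal F.L γ b₀ p₀ i) * (s ^ 3 * ((F.L : ℝ)⁻¹) ^ (2 * j)) := by
    rw [← hs2]
    ring
  have hnn : 0 ≤ s ^ 3 * ((F.L : ℝ)⁻¹) ^ (2 * j) := by positivity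
  have key : θBal F.L γ b₀ p₀ i * ((F.L : ℝ)⁻¹) ^ (2 * (j + 1)) ≤ s ^ 3 * (θBal F.L γ b₀ p₀ (i + 1) * ((F.L : ℝ)⁻¹) ^ (2 * j)) := by
    rw [e]
    calc (s * θBal F.L γ b₀ p₀ i) * (s ^ 3 * ((F.L : ℝ)⁻¹) ^ (2 * j))
        ≤ θBal F.L γ b₀ p₀ (i + 1) * (s ^ 3 * ((F.L : ℝ)⁻¹) ^ (2 * j)) := mul_le_mul_of_nonneg_right hstep hnn
      _ = s ^ 3 * (θBal F.L γ b₀ p₀ (i + 1) * ((F.L : ℝ)⁻¹) ^ (2 * j)) := by ring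
  exact fun q => (hχ q).trans_le key

/-- **IN PARTICULAR THE PLAIN LEVEL-`j` CONDITION HOLDS** (`(√(L⁻¹))³ ≤ 1`, thresholds nonnegative). [cite: Balaban1985UV3, (47) p.267] -/
theorem printChi_step (hγ : 0 < γ) (hγ1 : γ ≤ 1) (hb : 0 < b₀) (hp : 0 ≤ p₀) {K : ℕ} (i j : ℕ)
    {U : GaugeField (F.P K) 0 (Matrix.specialUnitaryGroup (Fin 2) ℂ)}
    (hχ : PlaqSmall (θBal F.L γ b₀ p₀ i * ((F.L : ℝ)⁻¹) ^ (2 * (j + 1))) U) :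
    PlaqSmall (θBal F.L γ b₀ p₀ (i + 1) * ((F.L : ℝ)⁻¹) ^ (2 * j)) U := by
  have hL : 1 ≤ F.L := F.hL.2.le
  have hL1 : (1 : ℝ) ≤ (F.L : ℝ) := by exact_mod_cast hL
  have hθ : 0 ≤ θBal F.L γ b₀ p₀ (i + 1) * ((F.L : ℝ)⁻¹) ^ (2 * j) :=
    mul_nonneg (T3MinimiserStabilityReduction.θBal_pos hL hγ hγ1 hb p₀ (i + 1)).le (by positivity)
  have hs1 : Real.sqrt ((F.L : ℝ)⁻¹) ^ 3 ≤ 1 :=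
    pow_le_one₀ (Real.sqrt_nonneg _) (Real.sqrt_le_one.mpr (inv_le_one_of_one_le₀ hL1))
  have key : Real.sqrt ((F.L : ℝ)⁻¹) ^ 3 * (θBal F.L γ b₀ p₀ (i + 1) * ((F.L : ℝ)⁻¹) ^ (2 * j)) ≤
      θBal F.L γ b₀ p₀ (i + 1) * ((F.L : ℝ)⁻¹) ^ (2 * j) := by
    calc Real.sqrt ((F.L : ℝ)⁻¹) ^ 3 * (θBal F.L γ b₀ p₀ (i + 1) * ((F.L : ℝ)⁻¹) ^ (2 * j))
        ≤ 1 * (θBal F.L γ b₀ p₀ (i + 1) * ((F.L : ℝ)⁻¹) ^ (2 * j)) := mul_le_mul_of_nonneg_right hs1 hθ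
      _ = _ := one_mul _
  have h := printChi_step_margin hγ hγ1 hb.le hp i j hχ
  exact fun q => (h q).trans_le key

end Heredity

end Summit.QuantumFields.YangMills.Theorems.LogComparisonRepAtHeightsOn

end
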